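import Literature.MathematicalPhysics.QuantumFieldTheory.Balaban1983to89.B8Ineq159FlatCubeMemberKernel
import Literature.MathematicalPhysics.QuantumFieldTheory.Balaban1983to89.B8TowerBondsPrinted
import Literature.MathematicalPhysics.QuantumFieldTheory.Balaban1983to89.B8TowerBondsNonempty

/-!
# `Balaban1983to89.B8Ineq159FlatTopCubeMemberKernel` — KERNEL CERTIFICATE ON THE `Ω₀ = ℤᵈ` ROAD: at print's family `(T, □₁, …, □_k)` of
# [Balaban1985RegularSpaces] (1.131) (`Ω₀ = ℤᵈ`, `Ω_j = □_j`, `Λ′₀ = ℤᵈ ∖ □₁`, truncated tower `cubeLamS … m` above level `0`) with the REPAIRED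
# constraint-bond class `B8TowerBondsPrinted.towerBondsP` (dag-n05-d, print's (1.31) ∕ [B6] (2.3) inner + crossing bonds), a flat-background
# bond function in the Landau gauge of record on `ℤᵈ` with `J = D^{η*}_1D^η_1φ ≡ 0` and ZERO un-normalised flat averages on every bond of the
# class at every level `j ≤ m` is IDENTICALLY ZERO — no support hypothesis: the level-`0` class data kill `φ` off the bonds of `□₁`

statement-level skeleton of published theorems with citation tags; proofs where landed; nothing here is a claim about the
Yang–Mills mass gap

`[Balaban1985RegularSpaces]` ("B8", CMP **99** (1985) 75–102) (1.31) p. 82, (1.38) p. 82, (1.55) p. 86, (1.58)–(1.59) p. 86, (1.131) p. 99 («Λ′₀ = T ∖ □₁»),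
p. 77; `[Balaban1984PropagatorsII]` ("B6", CMP **96** (1984) 223–250) (2.3) p. 224, (2.7) p. 224, (2.11)–(2.12) p. 225; `[Balaban1985BackgroundPropagators]`
("[4]") (3.4) p. 391, (3.19) p. 393, (3.23)–(3.25) p. 394.

CITATION HEADER (lean-in-tree rule).  Cell `pub-ymgap` (YM Track A, HUMAN RULING D-0062 ∕ D-0149), DAG node N05 = [B8], width seat
`pub-ymgap-dag-n05-w3` (g0), INTENT-5 (bus 2026-08-28 ≈00:05Z).  WHY.  dag-n05-c certified that over the TYPED class `towerBonds` the
(1.59)-socket of Proposition 3's frame is false at the lawful `k = 1` shell member of print's family `(T, □₁)` at `U₀ = 1`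
(`B8SockB9P3ShellModeVacuityUniv`, p576185); dag-n05-d typed PRINT's tower class `towerBondsP` (p582555) for the `Ω₀ = ℤᵈ` road and the P-carrier
edition reads its (1.42)-hypothesis on it.  THIS FILE is the `Ω₀ = ℤᵈ` twin of this seat's cube-member certificate
(`B8Ineq159FlatCubeMemberKernel.eq_zero_of_ineq159FlatData_eq_zero`, p583885): over the repaired class the flat data admit NO zero mode at
print's family members, every `k ≥ 1`, `1 ≤ m ≤ k` (collar `L ≤ ρ`).  NOT a socket inhabitant (the sockets range over curved `U₀` — N06 content).

THE MATHEMATICS (kernel-checked; flat background, `Site d = ℤᵈ`).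
* §1 ★ `pairing_covLap_eq_zero_of_isLandau138_univ` — dag-n05-c's `B8Eq138LandauFlatOrthogonal.pairing_covLap_eq_zero_of_isLandau138` on the
  INFINITE region `Ω₀ = ℤᵈ`: the multiplier form `Δ^η_1(D^{η*}_1φ) = Q′(1)ᵀμ` on `ℤᵈ` with FINITELY SUPPORTED divergence `D^{η*}_1φ` gives
  `Σ_x (Δ^η_1λ)(x)·(D^{η*}_1φ)(x) = 0` for every finitely supported `λ ∈ N(Q′)` (`λ = 0` on `Λ₀`, zero `Lʲ`-block sums on `Λ_j`, `1 ≤ j ≤ m`).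
* §2 geometry of the print family's tower: `inBox_bondBox_of_under`, ★ `cubeLamBP_subset_towerBondsP_topCube` (`1 ≤ j ≤ m ≤ k`, `1 ≤ L ≤ ρ`):
  dag-n05-c's one-class index `cubeLamBP … m j` at the cube member lies in `towerBondsP L Ω Λs j` for `Ω = cubeFam true …`, `Λs 0 = (□₁)ᶜ`,
  `Λs j = cubeLamS … m j` (`j ≥ 1`) — inner bonds have their fine box in `□_j`, the bonds sticking out of `□_j^{(j)}` have it in `□_{j−1}` with the
  `L`-block under the outer end in `Λ_{j−1}` (the collar).
* §3 ★★★ `eq_zero_of_topCube_flatData_eq_zero` — assembly: level-`0` class data (`towerBondsP … 0 = towerBonds … 0`: both ends in `ℤᵈ ∖ □₁`) ⇒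
  `φ = 0` off the bonds of `□₁`; `J ≡ 0` ⇒ closed (`B8FlatBondCalculusZd`) ⇒ Poincaré on the box `□₁` ⇒ `φ = D^η_1λ`, `λ` supported in `□₁`
  (so `λ = 0` on `Λ′₀`); class data at levels `1 ≤ j ≤ m` via §2 ⇒ `B8Ineq159FlatCubeMemberKernel.blockSum_eq_zero_of_classData` ⇒ `λ̄ ∈ N(Q′)`;
  §1 with `λ̄` ⇒ `Σ_x |Δ^η_1λ|² = 0` ⇒ Dirichlet energy ⇒ `λ = 0`, `φ = 0`.

HONEST SCOPE.  A uniqueness certificate (lattice calculus + combinatorics + [B6] (2.11)'s positivity); no estimate with constants; nothing of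
Bałaban's analysis asserted; count-neutral; N05 NOT discharged; no count claim; one finite `T⁴` programme at fixed `ε`, Bałaban as printed; the YM
mass gap (Clay) is NOT proved by any of this — R4 closes the conditional finite-`𝕋⁴` rung `BalabanLadder.UV` only; nothing continuum ∕ ℝ⁴ ∕ OS.
No `sorry`, no `def`, no `instance`, no `notation`.  Unit `pub-ymgap-dag-n05-w3` (g0), 2026-08-28.
-/

noncomputable section

open ComplexConjugate

namespace Literature.MathematicalPhysics.QuantumFieldTheory.Balaban1983to89.B8Ineq159FlatTopCubeMemberKernel

open B7Prop1Explicit B7Prop2Explicit B7Prop1Local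
open B7Prop4GeneralLevels (linCovIter linCovIter_zero)
open B8Ineq132 (covDerivFwd BondTouches Under)
open B8Eq146AExpansion (iEta plaqCovDeriv)
open B8Eq155JBound (Jcur)
open B8Eq138LandauZd (IsLandau138 covLap covDivB QT)
open B8Eq131Cubes (cube sqLo sqHi inLo inHi mem_cube_iff)
open B8Eq131CubesAdmissible (cubeFam cubeFam_true_zero cubeFam_of_pos smul_mem_cube_iff)
open B8CubeMemberZd (cubeLam cubeLamS cubeLamS_of_lt cubeLamS_self under_smul_iff)
open B8IdxB8LawsB (towerBonds under_or_of_bondBox)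
open B8TowerBondsPrinted (towerBondsP towerBondsP_zero_eq)
open B8Ineq159FlatCubeMemberPrinted (cubeLamBP cubeLamBP_box_subset_pred)
open B8Eq191FlatStencils (covDerivFwd_flat_apply QT_flat_apply)
open B8Eq191FlatLettersCubeMember (inBox_finite under_iff_blockMap_eq under_smul_self)
open B8FlatBondCalculusZd (not_inBox_of_hi_lt plaqCovDeriv_eq_zero_of_conj_mul_Jcur_eq_zero
  exists_eq_covDerivFwd_of_plaqCovDeriv_eq_zero linCovIter_one_grad sum_blockSites_one)
open B8Ineq159FlatShellModeCrossingDatum (finsum_mul_covLap_symm support_covLap_finite eq_zero_of_finsum_conj_mul_self_eq_zero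
  shift_eq_of_finsum_conj_mul_covLap_self_eq_zero)
open B8Eq138LandauFlatOrthogonal (sum_mul_comp_blockMap)
open B8Ineq159FlatCubeMemberKernel (blockSum_eq_zero_of_classData inBox_sq_succ_blockMap_of_inBox_in blockMap_eq_of_mem_blockSites
  covLap_flat_conj)
open B8Ineq166Univ (under_add_of_under)
open Literature.MathematicalPhysics.QuantumLattice (blockMap blockSites mem_blockSites_iff blockMap_one)

export B7Prop1Explicit (Site)

variable {d : ℕ}

/-! ## §1 The flat Landau condition of record on `Ω₀ = ℤᵈ`: orthogonality to `Δ N(Q′)` -/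

/-- ★ **MULTIPLIER FORM ⇒ ORTHOGONALITY FORM ON `Ω₀ = ℤᵈ`**: if `Δ^η_1(D^{η*}_1φ) = Q′(1)ᵀμ` on the whole lattice (`IsLandau138 L m η univ Λs 1 φ`)
and `D^{η*}_1φ` is finitely supported, then `Σ_x (Δ^η_1λ)(x)·(D^{η*}_1φ)(x) = 0` for every finitely supported gauge function `λ ∈ N(Q′)` — `λ = 0` on
`Λ₀ = Λs 0`, `Σ_{x∈Bʲ(y)} λ(x) = 0` for `y ∈ Λs j`, `1 ≤ j ≤ m`.  (dag-n05-c's p580574 verbatim with `Ω₀.indicator` absent.)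
[cite: Balaban1985RegularSpaces, (1.38) p.82, (1.29) p.81; Balaban1984PropagatorsII, (2.7) p.224, (2.12) p.225; Balaban1985BackgroundPropagators, (3.19) p.393, (3.24)–(3.25) p.394] -/
theorem pairing_covLap_eq_zero_of_isLandau138_univ {L m : ℕ} (hL : 1 ≤ L) {η : ℝ} {Λs : ℕ → Set (Site d)}
    {φ : Site d → Fin d → ℂ} (h : IsLandau138 L m η (Set.univ : Set (Site d)) Λs (1 : Site d → Fin d → ℂˣ) φ)
    (hdiv : (Function.support (covDivB η (1 : Site d → Fin d → ℂˣ) φ)).Finite)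
    {lam : Site d → ℂ} (hlam : (Function.support lam).Finite) (h0 : ∀ x ∈ Λs 0, lam x = 0)
    (hQ : ∀ j, 1 ≤ j → j ≤ m → ∀ y ∈ Λs j, ∑ x ∈ blockSites (L ^ j) y, lam x = 0) :
    ∑ᶠ x, covLap η (1 : Site d → Fin d → ℂˣ) lam x * covDivB η (1 : Site d → Fin d → ℂˣ) φ x = 0 := by
  classical
  obtain ⟨μ, hμ⟩ := h
  have hμ' : ∀ x, covLap η (1 : Site d → Fin d → ℂˣ) (covDivB η (1 : Site d → Fin d → ℂˣ) φ) x =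
      QT L m Λs (1 : Site d → Fin d → ℂˣ) μ x := fun x => by
    have := hμ x (Set.mem_univ x)
    rwa [Set.indicator_univ] at this
  -- move `Δ^η_1` to the other side
  rw [← finsum_mul_covLap_symm η hlam hdiv]
  set S := hlam.toFinset with hSdef
  have hS : Function.support lam ⊆ ↑S := fun x hx => by rw [hSdef, Set.Finite.coe_toFinset]; exact hx
  rw [finsum_eq_sum_of_support_subset _ (fun x hx => hS (Function.support_mul_subset_left _ _ hx))]
  have hrow : ∀ x ∈ S, lam x * covLap η (1 : Site d → Fin d → ℂˣ) (covDivB η (1 : Site d → Fin d → ℂˣ) φ) x =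
      ∑ j ∈ Finset.range (m + 1), (((L : ℝ) ^ d)⁻¹) ^ j • (lam x * (Λs j).indicator (μ j) (blockMap (L ^ j) x)) := by
    intro x _
    rw [hμ' x, QT_flat_apply, Finset.mul_sum]
    refine Finset.sum_congr rfl fun j _ => ?_
    rw [mul_smul_comm]
  rw [Finset.sum_congr rfl hrow, Finset.sum_comm]
  refine Finset.sum_eq_zero fun j hj => ?_
  rw [← Finset.smul_sum, smul_eq_zero]
  right
  rcases Nat.eq_zero_or_pos j with rfl | hjpos
  · refine Finset.sum_eq_zero fun x _ => ?_
    rw [pow_zero, blockMap_one]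
    by_cases hx0 : x ∈ Λs 0
    · rw [h0 x hx0, zero_mul]
    · rw [Set.indicator_of_notMem hx0, mul_zero]
  · haveI : NeZero (L ^ j) := ⟨by positivity⟩
    rw [sum_mul_comp_blockMap hS]
    refine Finset.sum_eq_zero fun y _ => ?_
    by_cases hy : y ∈ Λs j
    · rw [hQ j hjpos (by simpa [Finset.mem_range, Nat.lt_succ_iff] using hj) y hy, mul_zero]
    · rw [Set.indicator_of_notMem hy, zero_mul]

/-! ## §2 The print family's tower: dag-n05-c's one-class index lies in print's tower class -/

/-- A site of the block `Bʲ(z)` lies in the fine box `Bʲ(z) ∪ Bʲ(z + e_μ)` of the bond `⟨z, z + e_μ⟩`. [cite: Balaban1985Averaging, p.24 (sentence after (43))] -/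
theorem inBox_bondBox_of_under {L : ℕ} (hL : 1 ≤ L) (j : ℕ) (z : Site d) (μ : Fin d) {x : Site d} (hx : Under L j z x) :
    InBox (loK L j z) (bondHiK L j z μ) x := by
  intro i
  have hLj : (0 : ℤ) ≤ (L : ℤ) ^ j := by positivity
  obtain ⟨h1, h2⟩ := hx i
  simp only [loK, bondHiK]
  refine ⟨h1, ?_⟩
  have h3 : x i ≤ (L : ℤ) ^ j * z i + ((L : ℤ) ^ j - 1) := by
    have := h2; rw [mul_add, mul_one] at this; linarith
  split_ifs <;> linarith

/-- ★ **dag-n05-c's CUBE-MEMBER CLASS LIES IN PRINT'S TOWER CLASS over print's family `(T, □₁, …, □_k)`** (`1 ≤ j ≤ m ≤ k`, `1 ≤ L ≤ ρ`; `Ω = cubeFam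
true …`, `Λs 0 = (□₁)ᶜ`, `Λs j = cubeLamS … m j` for `j ≥ 1`): a level-`j` bond with at least one end in `□_j^{(j)}` and no end in `□_{j+1}^{(j)}`
(when `j < m`) is either INNER (both ends in `Λs j`, fine box in `Ω_j = □_j`) or CROSSING in the sense of (1.31) (outer end's `L`-block in `Λs (j−1)`,
fine box in `Ω_{j−1}` — the collar `ρ ≥ L`). [cite: Balaban1985RegularSpaces, (1.31) p.82, (1.131) p.99, p.98; Balaban1984PropagatorsII, (2.3) p.224] -/
theorem cubeLamBP_subset_towerBondsP_topCube {L : ℕ} (hL : 1 ≤ L) (a : Site d) (M : ℕ) {ρ : ℕ} (hρ : L ≤ ρ) {k m : ℕ}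
    (hmk : m ≤ k) {Λs : ℕ → Set (Site d)} (hΛ0 : Λs 0 = (cube L a M ρ k 1)ᶜ)
    (hΛ : ∀ j, 1 ≤ j → Λs j = cubeLamS L a M ρ k m j) {j : ℕ} (hj1 : 1 ≤ j) (hjm : j ≤ m) :
    cubeLamBP L a M ρ k m j ⊆ towerBondsP L (cubeFam true L a M ρ k) Λs j := by
  intro c hc
  have hjk : j ≤ k := hjm.trans hmk
  have hc' := hc
  obtain ⟨-, hends, hdeep⟩ := hc'
  -- membership of a level-`j` site in `Λs j`
  have hΛj : ∀ z, InBox (sqLo L a ρ k j) (sqHi L a M ρ k j) z →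
      (j < m → ¬ InBox (inLo L a ρ k j) (inHi L a M ρ k j) z) → z ∈ Λs j := by
    intro z hz hz'
    rw [hΛ j hj1]
    rcases lt_or_eq_of_le hjm with hlt | rfl
    · rw [cubeLamS_of_lt L a M ρ k hlt]; exact ⟨hz, fun _ => hz' hlt⟩
    · rw [cubeLamS_self]; exact hz
  -- the fine box of an inner pair lies in `□_j`
  have hΩj : cubeFam true L a M ρ k j = cube L a M ρ k j := cubeFam_of_pos true L a M ρ hj1 hjk
  have hinnerbox : InBox (sqLo L a ρ k j) (sqHi L a M ρ k j) c.1 → InBox (sqLo L a ρ k j) (sqHi L a M ρ k j) (c.1 + e c.2) →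
      ∀ x, InBox (loK L j c.1) (bondHiK L j c.1 c.2) x → x ∈ cubeFam true L a M ρ k j := by
    intro h1 h2 x hx
    rw [hΩj]
    rcases under_or_of_bondBox j c.1 c.2 hx with hu | hu
    · exact (mem_cube_iff hL).2 ⟨c.1, h1, hu⟩
    · exact (mem_cube_iff hL).2 ⟨c.1 + e c.2, h2, hu⟩
  -- the fine box of any class bond lies in `Ω_{j−1}`
  have hpredbox : ∀ x, InBox (loK L j c.1) (bondHiK L j c.1 c.2) x → x ∈ cubeFam true L a M ρ k (j - 1) := by
    intro x hx
    rcases Nat.eq_or_lt_of_le hj1 with h1 | h1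
    · rw [← h1, Nat.sub_self, cubeFam_true_zero]; exact Set.mem_univ x
    · rw [cubeFam_of_pos true L a M ρ (by omega) (by omega)]
      exact cubeLamBP_box_subset_pred hL a M hρ hj1 hmk hc x hx
  -- the `L`-block under an OUTER end adjacent to `□_j^{(j)}` lies in `Λs (j−1)`
  have houter : ∀ w : Site d, ¬ InBox (sqLo L a ρ k j) (sqHi L a M ρ k j) w →
      (∀ y, Under L 1 w y → ((L : ℤ) ^ (j - 1)) • y ∈ cubeFam true L a M ρ k (j - 1)) →
      ∀ x, (L : ℤ) • w ≤ x → x ≤ (L : ℤ) • w + B8Thm2LogB.blockTop L → x ∈ Λs (j - 1) := by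
    intro w hw hblk x hx1 hx2
    have hux : Under L 1 w x := by
      intro i
      have a1 := hx1 i; have a2 := hx2 i
      simp only [Pi.smul_apply, smul_eq_mul, Pi.add_apply, B8Thm2LogB.blockTop] at a1 a2
      constructor <;> [rw [pow_one]; (rw [pow_one]; linarith)]
      exact a1
    have hbm : blockMap L x = w := by
      have := (under_iff_blockMap_eq hL 1 w x).1 hux; rwa [pow_one] at this
    rcases Nat.eq_or_lt_of_le hj1 with h1 | h1
    · -- `j = 1`: `Λs 0 = (□₁)ᶜ`
      rw [← h1, Nat.sub_self, hΛ0]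
      intro hx
      obtain ⟨z, hz, hu⟩ := (mem_cube_iff hL).1 hx
      have : blockMap (L ^ 1) x = z := (under_iff_blockMap_eq hL 1 z x).1 hu
      rw [pow_one, hbm] at this
      rw [← h1] at hw
      exact hw (this ▸ hz)
    · -- `j ≥ 2`: `Λs (j−1) = Λ_{j−1}`
      have hj1' : 1 ≤ j - 1 := by omega
      rw [hΛ (j - 1) hj1', cubeLamS_of_lt L a M ρ k (show j - 1 < m by omega)]
      refine ⟨?_, fun _ hin => hw ?_⟩
      · -- the `(j−1)`-block of `x` lies in `□_{j−1}`
        have hmem := hblk x hux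
        rw [cubeFam_of_pos true L a M ρ hj1' (by omega)] at hmem
        exact (smul_mem_cube_iff hL a M ρ k (j - 1) x).1 hmem
      · have := inBox_sq_succ_blockMap_of_inBox_in hL a M ρ (show j - 1 < k by omega) hin
        rw [show j - 1 + 1 = j by omega, hbm] at this
        exact this
  -- the `L`-block of an outer end blows up into the bond's fine box
  have hblk_of_box : ∀ w : Site d, (w = c.1 ∨ w = c.1 + e c.2) →
      ∀ y, Under L 1 w y → ((L : ℤ) ^ (j - 1)) • y ∈ cubeFam true L a M ρ k (j - 1) := by
    intro w hw y hy
    refine hpredbox _ ?_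
    have hu : Under L j w (((L : ℤ) ^ (j - 1)) • y) := by
      have h2 : Under L (1 + (j - 1)) w (((L : ℤ) ^ (j - 1)) • y) := under_add_of_under hy (under_smul_self hL (j - 1) y)
      rwa [show 1 + (j - 1) = j by omega] at h2
    rcases hw with rfl | rfl
    · exact inBox_bondBox_of_under hL j c.1 c.2 hu
    · -- the block of `c.1 + e` is the upper half of the bond box
      intro i
      obtain ⟨h1, h2⟩ := hu i
      have hLj : (0 : ℤ) ≤ (L : ℤ) ^ j := by positivity
      simp only [loK, bondHiK]
      rw [add_e_apply] at h1 h2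
      constructor
      · split_ifs at h1 <;> nlinarith
      · have h3 : ((L : ℤ) ^ (j - 1) • y) i ≤ (L : ℤ) ^ j * ((c.1 i + if i = c.2 then 1 else 0)) + ((L : ℤ) ^ j - 1) := by
          have := h2; rw [mul_add, mul_one] at this; linarith
        split_ifs at h3 ⊢ with hi <;> nlinarith
  by_cases h1 : InBox (sqLo L a ρ k j) (sqHi L a M ρ k j) c.1
  · by_cases h2 : InBox (sqLo L a ρ k j) (sqHi L a M ρ k j) (c.1 + e c.2)
    · -- inner bond
      exact Or.inl ⟨hinnerbox h1 h2, hΛj _ h1 fun h => (hdeep h).1, hΛj _ h2 fun h => (hdeep h).2⟩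
    · -- crossing, outer end `c.1 + e`
      refine Or.inr ⟨hpredbox, Or.inr ⟨j - 1, by omega, hΛj _ h1 fun h => (hdeep h).1, ?_⟩⟩
      exact houter (c.1 + e c.2) h2 (hblk_of_box _ (Or.inr rfl))
  · -- crossing, outer end `c.1`
    have h2 : InBox (sqLo L a ρ k j) (sqHi L a M ρ k j) (c.1 + e c.2) := hends.resolve_left h1
    refine Or.inr ⟨hpredbox, Or.inl ⟨j - 1, by omega, ?_, hΛj _ h2 fun h => (hdeep h).2⟩⟩
    exact houter c.1 h1 (hblk_of_box _ (Or.inl rfl))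

/-! ## §3 The kernel theorem on the `Ω₀ = ℤᵈ` road -/

/-- ★★★ **THE REPAIRED FLAT DATA OVER PRINT'S TOWER CLASS DETERMINE THE FIELD — `Ω₀ = ℤᵈ` ROAD, PRINT'S FAMILY `(T, □₁, …, □_k)`.**  Let `d ≥ 2`,
`1 ≤ L ≤ ρ`, `η > 0`, a cube datum `(a, M, ρ, k)` and a truncation `1 ≤ m ≤ k`; regions `Ω = cubeFam true …` (`Ω₀ = ℤᵈ`, `Ω_j = □_j`) and
restriction sets `Λs` with `Λs 0 = ℤᵈ ∖ □₁` ((1.131) «Λ′₀ = T ∖ □₁») and `Λs j = cubeLamS … m j` for `j ≥ 1` (dag-n05-c's lawful member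
`exists_topCube_member_lawsB`, every truncation).  If `φ : ℤᵈ → (Fin d → ℂ)` is in the flat Landau gauge of record on `ℤᵈ`
(`IsLandau138 L m η univ Λs 1 φ`), its current vanishes everywhere (`Jcur η 1 φ ≡ 0`), and every un-normalised flat average over the REPAIRED class
vanishes (`linCovIter L 1 (iηφ) j c = 0`, `c ∈ towerBondsP L Ω Λs j`, `j ≤ m`), then `φ = 0`.  No support or boundedness hypothesis is needed: the
level-`0` class (both ends in `Λ′₀`) forces `φ = 0` off the bonds of `□₁`.  Contrast: over the typed class `towerBonds` the same data admit the
shell gauge modes (`B8SockB9P3ShellModeVacuityUniv`, p576185). [cite: Balaban1984PropagatorsII, (2.11) p.225, (2.3) p.224, (2.7) p.224; Balaban1985RegularSpaces, (1.31) p.82, (1.38) p.82, (1.59) p.86, (1.131) p.99; Balaban1985BackgroundPropagators, (3.25) p.394] -/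
theorem eq_zero_of_topCube_flatData_eq_zero (hd2 : 2 ≤ d) {L : ℕ} (hL : 1 ≤ L) {η : ℝ} (hη : 0 < η) (a : Site d) (M : ℕ)
    {ρ : ℕ} (hρ : L ≤ ρ) {k m : ℕ} (hm1 : 1 ≤ m) (hmk : m ≤ k) {Λs : ℕ → Set (Site d)}
    (hΛ0 : Λs 0 = (cube L a M ρ k 1)ᶜ) (hΛ : ∀ j, 1 ≤ j → Λs j = cubeLamS L a M ρ k m j)
    {φ : Site d → Fin d → ℂ}
    (hLan : IsLandau138 L m η (Set.univ : Set (Site d)) Λs (1 : Site d → Fin d → ℂˣ) φ)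
    (hJ : ∀ (y : Site d) (τ : Fin d), Jcur η (1 : Site d → Fin d → ℂˣ) φ τ y = 0)
    (hdata : ∀ j, j ≤ m → ∀ c ∈ towerBondsP L (cubeFam true L a M ρ k) Λs j,
      linCovIter L (1 : Site d → Fin d → ℂˣ) (iEta η φ) j c.1 c.2 = 0) :
    φ = 0 := by
  classical
  have hd1 : 1 ≤ d := by omega
  have hk : 1 ≤ k := hm1.trans hmk
  have hηC : (η : ℂ) ≠ 0 := Complex.ofReal_ne_zero.2 hη.ne'
  -- the box `□₁` on the fine lattice
  set lo : Site d := B8Ineq130.tlo L (sqLo L a ρ k 1) 1 with hlo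
  set hi : Site d := B8Ineq130.thi L (sqHi L a M ρ k 1) 1 with hhi
  have hbox : cube L a M ρ k 1 = {y | InBox lo hi y} := rfl
  -- (0) level-0 class data: `φ = 0` on every bond with both ends outside `□₁`
  have hout0 : ∀ (y : Site d) (τ : Fin d), y ∉ cube L a M ρ k 1 → y + e τ ∉ cube L a M ρ k 1 → φ y τ = 0 := by
    intro y τ hy hy'
    have hmem : (y, τ) ∈ towerBondsP L (cubeFam true L a M ρ k) Λs 0 := by
      rw [towerBondsP_zero_eq]
      refine ⟨fun x _ => by rw [cubeFam_true_zero]; exact Set.mem_univ x, Or.inl ⟨?_, ?_⟩⟩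
      · rw [hΛ0]; exact hy
      · rw [hΛ0]; exact hy'
    have h := hdata 0 (Nat.zero_le m) (y, τ) hmem
    rw [linCovIter_zero] at h
    simp only [B8Eq146AExpansion.iEta_def, smul_eq_zero, mul_eq_zero, Complex.I_ne_zero, hηC, false_or] at h
    exact h
  have hsupp : ∀ (y : Site d) (τ : Fin d), ¬ BondTouches {x | InBox lo hi x} y τ → φ y τ = 0 := by
    intro y τ h
    rw [← hbox] at h
    exact hout0 y τ (fun h' => h (Or.inl h')) (fun h' => h (Or.inr h'))
  -- finiteness of the supports
  have hφfin : ∀ τ, (Function.support fun x => φ x τ).Finite := by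
    intro τ
    refine (inBox_finite (lo - 1) hi).subset fun x hx => ?_
    rw [Function.mem_support] at hx
    have hbt : BondTouches {y | InBox lo hi y} x τ := by by_contra h; exact hx (hsupp x τ h)
    intro i
    rcases hbt with h | h
    · have := h i; simp only [Pi.sub_apply, Pi.one_apply]; omega
    · have := h i
      rw [add_e_apply] at this
      simp only [Pi.sub_apply, Pi.one_apply]
      split_ifs at this <;> omega
  -- (i) closed, (ii) Poincaré on `□₁`
  have hclosed : ∀ μ ν x, plaqCovDeriv η (1 : Site d → Fin d → ℂˣ) φ μ ν x = 0 :=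
    plaqCovDeriv_eq_zero_of_conj_mul_Jcur_eq_zero η hφfin fun x τ => by rw [hJ x τ, mul_zero]
  obtain ⟨lam, hgrad, hlam0⟩ := exists_eq_covDerivFwd_of_plaqCovDeriv_eq_zero hd2 hη.ne' lo hi hsupp hclosed
  have hφeq : φ = fun y τ => covDerivFwd η (1 : Site d → Fin d → ℂˣ) τ lam y := by
    funext y τ; exact (hgrad y τ).symm
  have hlam_out1 : ∀ x, x ∉ cube L a M ρ k 1 → lam x = 0 := fun x hx => hlam0 x (by rwa [hbox] at hx)
  have h10 : cube L a M ρ k 1 ⊆ cube L a M ρ k 0 := B8Eq131Cubes.cube_succ_subset (by omega)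
  have hlam_out0 : ∀ x, x ∉ cube L a M ρ k 0 → lam x = 0 := fun x hx => hlam_out1 x fun h => hx (h10 h)
  have hlamfin : (Function.support lam).Finite := (inBox_finite lo hi).subset fun x hx => by
    by_contra h; exact hx (hlam0 x h)
  obtain ⟨Λ, hΛ'⟩ : ∃ Λ : ℝ, ∀ x, ‖lam x‖ ≤ Λ := by
    refine ⟨∑ x ∈ hlamfin.toFinset, ‖lam x‖, fun x => ?_⟩
    by_cases hx : x ∈ hlamfin.toFinset
    · exact Finset.single_le_sum (f := fun x => ‖lam x‖) (fun _ _ => norm_nonneg _) hx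
    · rw [Set.Finite.mem_toFinset, Function.mem_support, not_not] at hx
      rw [hx, norm_zero]; exact Finset.sum_nonneg fun _ _ => norm_nonneg _
  -- (iii) class data at levels `1 ≤ j ≤ m` ⇒ block sums agree on `cubeLamBP`; at level `0` trivially (both ends off `□₁`)
  have hdata' : ∀ j, j ≤ m → ∀ c ∈ cubeLamBP L a M ρ k m j,
      ∑ x ∈ blockSites (L ^ j) (c.1 + e c.2), lam x = ∑ x ∈ blockSites (L ^ j) c.1, lam x := by
    intro j hj c hc
    rcases Nat.eq_zero_or_pos j with rfl | hjpos
    · -- both ends outside `□₁` (no end «deep» at level `0 < m`)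
      obtain ⟨-, -, hdeep⟩ := hc
      obtain ⟨h1, h2⟩ := hdeep (by omega)
      have hn1 : c.1 ∉ cube L a M ρ k 1 := fun h =>
        h1 ((B8Ineq159FlatCubeMemberKernel.inBox_in_zero_iff hL a M ρ hk c.1).2 h)
      have hn2 : c.1 + e c.2 ∉ cube L a M ρ k 1 := fun h =>
        h2 ((B8Ineq159FlatCubeMemberKernel.inBox_in_zero_iff hL a M ρ hk _).2 h)
      rw [pow_zero, sum_blockSites_one, sum_blockSites_one, hlam_out1 _ hn1, hlam_out1 _ hn2]
    · have hmem := cubeLamBP_subset_towerBondsP_topCube hL a M hρ hmk hΛ0 hΛ hjpos hj hc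
      have h := hdata j hj c hmem
      rw [hφeq, linCovIter_one_grad hL hη hΛ' j c.1 c.2, smul_eq_zero, mul_eq_zero] at h
      rcases h with h | h | h
      · exact absurd h (inv_ne_zero (pow_ne_zero _ (by exact_mod_cast (show L ≠ 0 by omega))))
      · exact absurd h Complex.I_ne_zero
      · exact sub_eq_zero.1 h
  have hQ := blockSum_eq_zero_of_classData hd1 hL a M ρ hmk hlam_out0 hdata'
  -- `λ̄ ∈ N(Q′)` for the tower `Λs`
  have h0 : ∀ x ∈ Λs 0, conj (lam x) = 0 := by
    intro x hx
    rw [hΛ0] at hx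
    rw [hlam_out1 x hx, map_zero]
  have hQ' : ∀ j, 1 ≤ j → j ≤ m → ∀ y ∈ Λs j, ∑ x ∈ blockSites (L ^ j) y, conj (lam x) = 0 := by
    intro j hj1 hjm y hy
    rw [← map_sum, hQ j hjm y fun hlt => ?_, map_zero]
    rw [hΛ j hj1, cubeLamS_of_lt L a M ρ k hlt] at hy
    exact hy.2 (by omega)
  -- (iv) the Landau pairing on `ℤᵈ` with `λ̄`: `Σ |Δλ|² = 0`
  have hconjfin : (Function.support fun x => conj (lam x)).Finite := by
    refine hlamfin.subset fun x hx => ?_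
    rw [Function.mem_support] at hx ⊢
    exact fun h => hx (by rw [h, map_zero])
  have hdiv : covDivB η (1 : Site d → Fin d → ℂˣ) φ = covLap η (1 : Site d → Fin d → ℂˣ) lam := by rw [hφeq]; rfl
  have hdivfin : (Function.support (covDivB η (1 : Site d → Fin d → ℂˣ) φ)).Finite := by
    rw [hdiv]; exact support_covLap_finite η hlamfin
  have hpair := pairing_covLap_eq_zero_of_isLandau138_univ hL hLan hdivfin hconjfin h0 hQ'
  rw [hdiv] at hpair
  simp_rw [covLap_flat_conj] at hpair
  have hPlam : covLap η (1 : Site d → Fin d → ℂˣ) lam = 0 :=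
    eq_zero_of_finsum_conj_mul_self_eq_zero (support_covLap_finite η hlamfin) hpair
  -- (v) Dirichlet energy: `λ` is translation invariant, hence zero
  have hDir : ∑ᶠ x, conj (lam x) * covLap η (1 : Site d → Fin d → ℂˣ) lam x = 0 := by
    simp_rw [hPlam, Pi.zero_apply, mul_zero]; exact finsum_zero
  have hshift := shift_eq_of_finsum_conj_mul_covLap_self_eq_zero hη.ne' hlamfin hDir
  have hlam : ∀ x, lam x = 0 := by
    intro x
    set i₀ : Fin d := ⟨0, by omega⟩
    have hall : ∀ t : ℕ, lam (x + (t : ℤ) • e i₀) = lam x := by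
      intro t
      induction t with
      | zero => simp
      | succ t ih => rw [show x + ((t + 1 : ℕ) : ℤ) • e i₀ = x + (t : ℤ) • e i₀ + e i₀ by
          push_cast; rw [add_smul, one_smul, add_assoc], hshift, ih]
    set n : ℕ := (hi i₀ + 1 - x i₀).toNat with hn
    rw [← hall n]
    refine hlam0 _ (not_inBox_of_hi_lt (i := i₀) ?_)
    rw [add_zsmul_e_apply, if_pos rfl, hn]
    simp only [Int.toNat_eq_max]
    rcases le_or_gt (hi i₀ + 1 - x i₀) 0 with h | h
    · rw [max_eq_right h]; omega
    · rw [max_eq_left h.le]; omega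
  funext y τ
  rw [hφeq]
  simp only [covDerivFwd_flat_apply, hlam, sub_zero, smul_zero, Pi.zero_apply]

#print axioms eq_zero_of_topCube_flatData_eq_zero

end Literature.MathematicalPhysics.QuantumFieldTheory.Balaban1983to89.B8Ineq159FlatTopCubeMemberKernel

end
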